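import Summits.HodgeConjecture.HodgeCM.Model.EmbInstance_1

/-! PORT of `HodgeCM/Model/EmbInstance.lean` (HodgeCMPerL run 82) — part 2: continuation of `Summits.HodgeConjecture.HodgeCM.Model.EmbInstance_1` (split at a top-level declaration boundary by port_pkg.py; scope re-opened below; declarations unchanged). -/

-- port_pkg: scope re-opened for this part (file-level context, then the namespace/section stack open at the cut)
noncomputable section
set_option autoImplicit false
open scoped Matrix ComplexOrder TensorProduct InnerProductSpace
open NumberField MeasureTheory
open Literature.AlgebraicGeometry.Motives
open Literature.AlgebraicGeometry.ShimuraVarieties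
open Literature.AlgebraicGeometry.HodgeTheory
open Literature.Geometry.Kaehler (holFormsInCharts)
open Literature.NumberTheory.Automorphic
open Literature.NumberTheory.Automorphic.PicardCM
namespace HodgeCM
namespace Model
section EndState
variable (hHD : exists_isReal_hodgeModel) (hI : hodgePQ_independent_of_hodgeModel)
  (h₁ : BallQuotientUniformised)  (h₃ : CMAbelianVarietyRealised)
section Lemmas
variable {L : CMField} {ι₁ : L →+* ℂ} {V : HermSpace3 L ι₁}
/-- **Inner products of `embLift`-images are Petersson integrals on the principal piece** ((T)
`inner_adelicHolFormLift` through the isometry): `⟪emb η', emb η⟫ = ∫_{Λ_K\U(V)(L ⊗ ℝ)} conj (L ω_{η'}) · L ω_η dμ₁`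
with `L := principalHolFormLiftCM` the forms-level lift of (T) § 1, `ω_η := embTopForm Γ η`, `K := Γ.K` and
`μ₁` the principal-piece measure folded from `regimeν` (Borel σ-algebra on the piece). [folklore] -/
theorem inner_embLift_eq_integral (Γ : Level V) (h : IsAnisotropic L V.Hm)
    (η η' : (picardCMUniverse hHD hI h₁ h₃).CohC ((picardCMUniverse hHD hI h₁ h₃).pms L ι₁ V Γ) 2) :
    ⟪embLift hHD hI h₁ h₃ Γ h η', embLift hHD hI h₁ h₃ Γ h η⟫_ℂ =
      ∫ q, inner ℂ
          ((embDatum h₁ h₃ Γ h).principalHolFormLiftCM (embHodgeModel hHD h₁ h₃ Γ)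
            (embFrameOf h₁ h₃ Γ h) L V.Hm ι₁
            (map_Hm_eq_ballDatum_H_map (ballQuotientUniformisedDatum_of h₁) h₃ Γ
              ((isAnisotropic_pmsCode_iff L ι₁ V Γ).2 h))
            Γ.K
            Γ.arithmeticLevel_K.le
            (map_Γ_le_ballDatum (ballQuotientUniformisedDatum_of h₁) h₃ Γ
              ((isAnisotropic_pmsCode_iff L ι₁ V Γ).2 h))
            (embTopForm hHD hI h₁ h₃ Γ η') q)
          ((embDatum h₁ h₃ Γ h).principalHolFormLiftCM (embHodgeModel hHD h₁ h₃ Γ)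
            (embFrameOf h₁ h₃ Γ h) L V.Hm ι₁
            (map_Hm_eq_ballDatum_H_map (ballQuotientUniformisedDatum_of h₁) h₃ Γ
              ((isAnisotropic_pmsCode_iff L ι₁ V Γ).2 h))
            Γ.K
            Γ.arithmeticLevel_K.le
            (map_Γ_le_ballDatum (ballQuotientUniformisedDatum_of h₁) h₃ Γ
              ((isAnisotropic_pmsCode_iff L ι₁ V Γ).2 h))
            (embTopForm hHD hI h₁ h₃ Γ η) q)
        ∂(LevelOrbit.pieceMeasure
            (UnitaryGroup.cmSplitLevel (L : Type) 3 V.Hm Γ.K)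
            (adelicUnitaryRat L V.Hm)
            (UnitaryGroup.cmSplitProj (L : Type) 3 V.Hm Γ.K)
            (UnitaryGroup.cmPrincipalPoint (L : Type) 3 V.Hm)
            (V.regimeν printFact_unitaryCompact_holds h)) := by
  rw [inner_embLift]
  exact (embDatum h₁ h₃ Γ h).inner_adelicHolFormLift (embHodgeModel hHD h₁ h₃ Γ) _ L V.Hm ι₁ _ _ _ _ _ _
    _ _ _

end Lemmas

/-- The binder type of `emb` in `Model.perL_picardCM_r4`, met on the nose. -/
example : ∀ {L : CMField} {ι₁ : L →+* ℂ} {V : HermSpace3 L ι₁} (Γ : Level V),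
    (picardCMUniverse hHD hI h₁ h₃).CohC ((picardCMUniverse hHD hI h₁ h₃).pms L ι₁ V Γ) 2 →ₗ[ℂ]
      (V.latticeModel printFact_unitaryCompact_holds).toQuotientModel.H :=
  fun Γ => embOf hHD hI h₁ h₃ Γ

end EndState

end Model

end HodgeCM

end
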